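import Literature.Topology.FourManifolds.FishtailIotaTwoLocal
import Literature.Topology.FourManifolds.FishtailEndModel
import Literature.Topology.FourManifolds.GluedDesc
import HarnessLib

/-!
# The fishtail end map on the model mapping torus

Infrastructure for the explicit fishtail neighbourhood (R. Gompf, *More Cappell–Shaneson spheres
are standard*, Algebr. Geom. Topol. 10 (2010), proof of Thm 2.1 and Lemma 2.2; the named fact
`Literature.Topology.FourManifolds.gompf2010_framedTwist`). The fishtail end model is the mapping
torus `MTorus Ψ` of the Dehn twist `Ψ (z₁, z₂, z₃) = (z₁, z₂, z₃ e^{i g(arg z₂)})`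
(`fishMonodromy`, step arc `[θ₀ - w, θ₀ + w]`), its end being `{im z₁ > 0}` (depth
`e = E₁ (1 - re z₁)/2 ∈ (0, E₁)`). `FishtailIotaTwo.lean` defines the end map `iotaTwo` on the
second cylinder; here we descend it to the mapping torus:

* `Literature.Topology.FourManifolds.IotaData.Ψ` — the model monodromy, and the equivariance
  `iotaTwo (Ψ x, s + 1) = iotaTwo (x, s)` on the box sector `s ∈ (1/4, 3/4)` (`iotaTwo_Ψ`: the
  clutching twist of the box fibre is the model monodromy);
* `IotaData.iotaOne` (first cylinder), `IotaData.iota` — the descended map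
  `MTorus Ψ → X^σ` (`SmoothGlueData.desc`), with `iota_inl`, `iota_inr`;
* `IotaData.isLocalDiffeomorphAt_iota` — a local diffeomorphism at every point of the end
  `{im z₁ > 0}` (under `LocHyp`), hence smooth there.

Everything is proved; no named facts.

## References

* R. E. Gompf, *More Cappell–Shaneson spheres are standard*, Algebr. Geom. Topol. 10 (2010)
  1665–1681, proof of Thm 2.1 and Lemma 2.2. [GompfAGT2010]
-/

noncomputable section

open scoped Real ContDiff Topology Manifold
open Set Function Filter Complex Metric

namespace Literature.Topology.FourManifolds

local notation "𝔼 " n:arg => EuclideanSpace ℝ (Fin n)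
local notation "𝓣" =>
  (ModelWithCorners.prod (𝓡 1) (ModelWithCorners.prod (𝓡 1) (𝓡 1)))

/-! ### Generic: the inclusion of an open submanifold is a local diffeomorphism -/

section OpensVal

variable {E H : Type*} [NormedAddCommGroup E] [NormedSpace ℝ E] [TopologicalSpace H]
  {I : ModelWithCorners ℝ E H} {M : Type*} [TopologicalSpace M] [ChartedSpace H M]

/-- **The inclusion of an open subset is a local diffeomorphism.** [folklore] -/
theorem isLocalDiffeomorphAt_subtypeVal_opens (U : TopologicalSpace.Opens M) (p : ↥U) :
    IsLocalDiffeomorphAt I I ∞ (Subtype.val : ↥U → M) p := by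
  have hne : Nonempty ↥U := ⟨p⟩
  let Φ : PartialDiffeomorph I I (↥U) M ∞ :=
    { toPartialEquiv := (U.openPartialHomeomorphSubtypeCoe hne).toPartialEquiv
      open_source := (U.openPartialHomeomorphSubtypeCoe hne).open_source
      open_target := (U.openPartialHomeomorphSubtypeCoe hne).open_target
      contMDiffOn_toFun := contMDiffOn_openPartialHomeomorphSubtypeCoe U hne
      contMDiffOn_invFun := contMDiffOn_openPartialHomeomorphSubtypeCoe_symm U hne }
  refine ⟨Φ, ?_, fun q _ ↦ rfl⟩
  show p ∈ (U.openPartialHomeomorphSubtypeCoe hne).source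
  rw [TopologicalSpace.Opens.openPartialHomeomorphSubtypeCoe_source]
  exact mem_univ _

end OpensVal

namespace IotaData

variable (J : IotaData)

/-! ### The model monodromy -/

/-- **Hypotheses for the model step arc** `[θ₀ - w, θ₀ + w] ⊂ (0, π)`. [folklore] -/
structure ModelHyp : Prop where
  hw : 0 < J.wS
  hθw : J.wS < J.θ₀
  hθπ : J.θ₀ + J.wS < π

variable {J} in
/-- `0 < θ₀ - w`. [folklore] -/
theorem ModelHyp.ha (H : J.ModelHyp) : 0 < J.θ₀ - J.wS := by linarith [H.hθw]

variable {J} in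
/-- `θ₀ - w < θ₀ + w`. [folklore] -/
theorem ModelHyp.hab (H : J.ModelHyp) : J.θ₀ - J.wS < J.θ₀ + J.wS := by linarith [H.hw]

variable {J} in
/-- `θ₀ + w < π`. [folklore] -/
theorem ModelHyp.hb (H : J.ModelHyp) : J.θ₀ + J.wS < π := H.hθπ

/-- **The model monodromy** `Ψ`: the Dehn twist of the fibre torus along `γ` with step arc
`[θ₀ - w, θ₀ + w]`. [cite: GompfAGT2010, Lemma 2.2 (proof: ∂Φ = ℝ × T²/(t, x) ∼ (t − 1, ψ(x)))] -/
def Ψ (H : J.ModelHyp) : ThreeTorus ≃ₘ⟮𝓣, 𝓣⟯ ThreeTorus := fishMonodromy H.ha H.hab H.hb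

/-- **The value of the model monodromy**: `Ψ (z₁, z₂, z₃) = (z₁, z₂, z₃ e^{2πi τ̂_w(arg z₂ - θ₀)})`. [folklore] -/
theorem Ψ_apply (H : J.ModelHyp) (x : ThreeTorus) :
    J.Ψ H x = (x.1, x.2.1, x.2.2 * Circle.exp (2 * π * stepW J.wS (arg (x.2.1 : ℂ) - J.θ₀))) := by
  obtain ⟨z₁, z₂, z₃⟩ := x
  have h := fishMonodromy_apply H.ha H.hab H.hb z₁ z₃ (arg (z₂ : ℂ))
  rw [Circle.exp_arg] at h
  rw [Ψ, h, gompfLift_eq_of_mem_Ioc _ _ ⟨neg_pi_lt_arg _, arg_le_pi _⟩, stepW]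
  simp only
  congr 4
  have hw := H.hw
  field_simp
  ring

/-- The monodromy preserves the depth circle and the vanishing cycle. [folklore] -/
@[simp] theorem Ψ_fst (H : J.ModelHyp) (x : ThreeTorus) : (J.Ψ H x).1 = x.1 := by rw [Ψ_apply]

/-- The monodromy preserves the vanishing cycle coordinate. [folklore] -/
@[simp] theorem Ψ_snd_fst (H : J.ModelHyp) (x : ThreeTorus) : (J.Ψ H x).2.1 = x.2.1 := by rw [Ψ_apply]

/-- The fibre coordinate of the monodromy. [folklore] -/
theorem Ψ_snd_snd (H : J.ModelHyp) (x : ThreeTorus) :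
    (J.Ψ H x).2.2 = x.2.2 * Circle.exp (2 * π * stepW J.wS (J.lat x.2.1 - J.nj)) := by
  rw [Ψ_apply, lat]; ring_nf

/-! ### Equivariance of the end map on the box sector -/

/-- `faceT`, `faceY` are `2π`-periodic in the shell angle. [folklore] -/
theorem faceT_sub_two_pi (θ e : ℝ) : faceT (θ - 2 * π) e = faceT θ e := by
  have h : bxR (θ - 2 * π) = bxR θ := boxR_congr (Real.sin_sub_two_pi θ)
  rw [faceT, faceT, h, Real.sin_sub_two_pi]

/-- `faceY` is `2π`-periodic in the shell angle. [folklore] -/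
theorem faceY_sub_two_pi (θ e : ℝ) : faceY (θ - 2 * π) e = faceY θ e := by
  have h : bxR (θ - 2 * π) = bxR θ := boxR_congr (Real.sin_sub_two_pi θ)
  rw [faceY, faceY, h, Real.cos_sub_two_pi]

/-- Off the hole sector the distance to the hole is `1`. [folklore] -/
theorem holeDist_of_ge {s : ℝ} (hs : 1 / 5 ≤ |s - 1|) (x : ThreeTorus) : J.holeDist x s = 1 := by
  rw [holeDist, if_neg (not_lt.2 hs)]

/-- Off the hole sector the end map is the box shell (`r_h ≤ r_c ≤ 1`). [folklore] -/
theorem iotaTwo_of_ge (hrh : J.rh ≤ J.rc) (hrc : J.rc ≤ 1) {x : ThreeTorus} {s : ℝ} (hs : 1 / 5 ≤ |s - 1|) :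
    J.iotaTwo (x, s) = J.boxP x s := by
  rw [iotaTwo]
  rw [glueBy_of_le (τ := fun p : ThreeTorus × ℝ ↦ J.holeDist p.1 p.2)
      (show J.rh ≤ J.holeDist x s by rw [J.holeDist_of_ge hs]; linarith),
    glueBy_of_le (τ := fun p : ThreeTorus × ℝ ↦ J.holeDist p.1 p.2) (show J.rc ≤ J.holeDist x s by rw [J.holeDist_of_ge hs]; exact hrc)]

/-- **Equivariance of the box shell**: `boxP (Ψ x) (s + 1) = boxP x s` for `s ≤ 1`, `s + 1 > 1`
— the clutching twist of the box fibre above the hole is the model monodromy. [cite: GompfAGT2010, Lemma 2.2 (proof: ∂Φ is the T²-bundle with monodromy the Dehn twist ψ)] -/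
theorem boxP_Ψ (H : J.ModelHyp) {x : ThreeTorus} {s : ℝ} (hs0 : 0 < s) (hs1 : s ≤ 1) :
    J.boxP (J.Ψ H x) (s + 1) = J.boxP x s := by
  have htw1 : J.twistC (J.lat x.2.1) (s + 1) = Circle.exp (-(2 * π * stepW J.wS (J.lat x.2.1 - J.nj))) := by
    rw [twistC, if_neg (by linarith)]
  have htw0 : J.twistC (J.lat x.2.1) s = 1 := by rw [twistC, if_pos hs1]
  have hf : (J.Ψ H x).2.2 * J.twistC (J.lat (J.Ψ H x).2.1) (s + 1) = x.2.2 := by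
    rw [Ψ_snd_fst, htw1, Ψ_snd_snd, mul_assoc, ← Circle.exp_add, add_neg_cancel, Circle.exp_zero, mul_one]
  rw [boxP, boxP, hf, Ψ_snd_fst, Ψ_fst, htw0, mul_one, thetaV_add_one, faceT_sub_two_pi, faceY_sub_two_pi]

/-- **Equivariance of the end map on the box sector** `s ∈ [1/4, 3/4]`. [folklore] -/
theorem iotaTwo_Ψ (H : J.ModelHyp) (hrh : J.rh ≤ J.rc) (hrc : J.rc ≤ 1) {x : ThreeTorus} {s : ℝ}
    (hs : s ∈ Icc (1 / 4 : ℝ) (3 / 4)) : J.iotaTwo (J.Ψ H x, s + 1) = J.iotaTwo (x, s) := by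
  rw [J.iotaTwo_of_ge hrh hrc (x := J.Ψ H x) (s := s + 1)
      (by rw [show s + 1 - 1 = s by ring, abs_of_pos (by linarith [hs.1])]; linarith [hs.1]),
    J.iotaTwo_of_ge hrh hrc (x := x) (s := s) (by rw [abs_of_nonpos (by linarith [hs.2])]; linarith [hs.2]),
    J.boxP_Ψ H (by linarith [hs.1]) (by linarith [hs.2])]

/-! ### The end map on the first cylinder and on the mapping torus -/

/-- **The end map on the first cylinder**: `ι₂ (Ψ x, s + 1)` for `s < 1/2`, `ι₂ (x, s)` for `s ≥ 1/2`. [folklore] -/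
def iotaOne (H : J.ModelHyp) (p : ThreeTorus × ℝ) : (fishNu J.hε J.hε2).Surgered :=
  glueBy (fun p : ThreeTorus × ℝ ↦ p.2) (1 / 2) (fun p ↦ J.iotaTwo (J.Ψ H p.1, p.2 + 1)) J.iotaTwo p

/-- Compatibility of the two cylinder maps with the mapping-torus gluing. [folklore] -/
theorem iota_compat (H : J.ModelHyp) (a : ThreeTorus × ↥mappingTorusPieceOne)
    (ha : a ∈ (mtGlueData (J.Ψ H)).glue.source) :
    J.iotaOne H (a.1, (a.2 : ℝ)) = J.iotaTwo (((mtGlueData (J.Ψ H)).glue a).1, (((mtGlueData (J.Ψ H)).glue a).2 : ℝ)) := by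
  have ha' : (a.2 : ℝ) ≠ 1 / 2 := ha
  change J.iotaOne H (a.1, (a.2 : ℝ)) = J.iotaTwo ((mtGlueFun (J.Ψ H) a).1, ((mtGlueFun (J.Ψ H) a).2 : ℝ))
  rcases ha'.lt_or_gt with h | h
  · rw [mtGlueFun_of_lt h, iotaOne, glueBy_of_lt (τ := fun p : ThreeTorus × ℝ ↦ p.2) h]
  · rw [mtGlueFun_of_gt h, iotaOne, glueBy_of_le (τ := fun p : ThreeTorus × ℝ ↦ p.2) h.le]

/-- **The fishtail end map on the model mapping torus** `MTorus Ψ → X^σ`. [cite: GompfAGT2010, Lemma 2.2 (the collar I × ∂Φ of the fishtail neighbourhood in X)] -/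
def iota (H : J.ModelHyp) : MTorus (J.Ψ H) → (fishNu J.hε J.hε2).Surgered :=
  (mtGlueData (J.Ψ H)).desc (fun a ↦ J.iotaOne H (a.1, (a.2 : ℝ))) (fun b ↦ J.iotaTwo (b.1, (b.2 : ℝ)))
    (J.iota_compat H)

/-- The end map on the first cylinder. [folklore] -/
@[simp] theorem iota_inl (H : J.ModelHyp) (a : ThreeTorus × ↥mappingTorusPieceOne) :
    J.iota H ((mtGlueData (J.Ψ H)).inl a) = J.iotaOne H (a.1, (a.2 : ℝ)) := rfl

/-- The end map on the second cylinder. [folklore] -/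
@[simp] theorem iota_inr (H : J.ModelHyp) (b : ThreeTorus × ↥mappingTorusPieceTwo) :
    J.iota H ((mtGlueData (J.Ψ H)).inr b) = J.iotaTwo (b.1, (b.2 : ℝ)) := rfl

/-- The end map through `mtPt`. [folklore] -/
theorem iota_mtPt_two (H : J.ModelHyp) (x : ThreeTorus) {s : ℝ} (hs : 1 / 2 < s ∧ s < 3 / 2) :
    J.iota H (mtPt (J.Ψ H) x s) = J.iotaTwo (x, s) := by
  rw [mtPt_of_mem_two x hs, iota_inr]

/-- The end map at a point of the first cylinder. [folklore] -/
theorem iota_mtPt_one (H : J.ModelHyp) (x : ThreeTorus) {s : ℝ} (hs : 0 < s ∧ s < 1) :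
    J.iota H (mtPt (J.Ψ H) x s) = J.iotaOne H (x, s) := by
  rw [mtPt_of_mem_one x hs, iota_inl]

/-! ### The depth circle of a point of the mapping torus and the model end -/

/-- **The depth circle `z₁` of a point of the mapping torus** (the monodromy preserves it). [folklore] -/
def z1Of (H : J.ModelHyp) : MTorus (J.Ψ H) → Circle :=
  (mtGlueData (J.Ψ H)).desc (fun a ↦ a.1.1) (fun b ↦ b.1.1) fun a ha ↦ by
    have ha' : (a.2 : ℝ) ≠ 1 / 2 := ha
    change a.1.1 = (mtGlueFun (J.Ψ H) a).1.1
    rcases ha'.lt_or_gt with h | h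
    · rw [mtGlueFun_of_lt h]; exact (J.Ψ_fst H a.1).symm
    · rw [mtGlueFun_of_gt h]

/-- The depth circle of a first-cylinder point. [folklore] -/
@[simp] theorem z1Of_inl (H : J.ModelHyp) (a : ThreeTorus × ↥mappingTorusPieceOne) :
    J.z1Of H ((mtGlueData (J.Ψ H)).inl a) = a.1.1 := rfl

/-- The depth circle of a second-cylinder point. [folklore] -/
@[simp] theorem z1Of_inr (H : J.ModelHyp) (b : ThreeTorus × ↥mappingTorusPieceTwo) :
    J.z1Of H ((mtGlueData (J.Ψ H)).inr b) = b.1.1 := rfl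

/-- The depth circle map is smooth. [folklore] -/
theorem contMDiff_z1Of (H : J.ModelHyp) : ContMDiff 𝓘(ℝ, 𝔼 4) (𝓡 1) ∞ (J.z1Of H) :=
  (mtGlueData (J.Ψ H)).contMDiff_desc _ (contMDiff_fst.comp contMDiff_fst) (contMDiff_fst.comp contMDiff_fst)

/-- **The model end** `𝒪 = {im z₁ > 0}` (depth `e ∈ (0, E₁)`), an open subset of the mapping torus. [cite: GompfAGT2010, Lemma 2.2 (proof: the collar I × ∂Φ)] -/
def endO (H : J.ModelHyp) : TopologicalSpace.Opens (MTorus (J.Ψ H)) :=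
  ⟨{p | 0 < ((J.z1Of H p : Circle) : ℂ).im},
    isOpen_lt continuous_const (continuous_im.comp (continuous_subtype_val.comp (J.contMDiff_z1Of H).continuous))⟩

/-- Membership in the model end. [folklore] -/
theorem mem_endO {H : J.ModelHyp} {p : MTorus (J.Ψ H)} : p ∈ J.endO H ↔ 0 < ((J.z1Of H p : Circle) : ℂ).im := Iff.rfl

/-! ### The end map is a local diffeomorphism on the model end -/

variable {J} {δ : ℝ}

/-- `LocHyp` gives `ModelHyp` provided `w < θ₀`. [folklore] -/
theorem LocHyp.modelHyp (HL : J.LocHyp δ) (hθw : J.wS < J.θ₀) : J.ModelHyp where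
  hw := HL.hw
  hθw := hθw
  hθπ := by
    have : J.wS ≤ 1 := by linarith [HL.hw1, HL.h12, HL.hΛ, HL.hrc1, HL.hδ]
    linarith [HL.hθ₀', Real.pi_gt_three]

variable (J)

/-- **The end map on the first cylinder is a local diffeomorphism** at every `(x, s)` of the model
end. [folklore] -/
theorem isLocalDiffeomorphAt_iotaOne (H : J.ModelHyp) (HL : J.LocHyp δ) {x : ThreeTorus} {s : ℝ}
    (hx : 0 < (x.1 : ℂ).im) :
    IsLocalDiffeomorphAt (ModelWithCorners.prod 𝓣 𝓘(ℝ, ℝ)) 𝓘(ℝ, 𝔼 4) ∞ (J.iotaOne H) (x, s) := by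
  have hrh : J.rh ≤ J.rc := by linarith [HL.hhc, HL.hδ]
  -- the shifted map `(x, s) ↦ ι₂ (Ψ x, s + 1)` is a local diffeomorphism
  have hshift : IsLocalDiffeomorphAt (ModelWithCorners.prod 𝓣 𝓘(ℝ, ℝ)) 𝓘(ℝ, 𝔼 4) ∞
      (fun p : ThreeTorus × ℝ ↦ J.iotaTwo (J.Ψ H p.1, p.2 + 1)) (x, s) := by
    let Sh : (ThreeTorus × ℝ) ≃ₘ⟮ModelWithCorners.prod 𝓣 𝓘(ℝ, ℝ), ModelWithCorners.prod 𝓣 𝓘(ℝ, ℝ)⟯ (ThreeTorus × ℝ) :=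
      (J.Ψ H).prodCongr (addConstDiffeo (1 : ℝ))
    have h1 := Sh.isLocalDiffeomorph (x, s)
    have h2 : IsLocalDiffeomorphAt (ModelWithCorners.prod 𝓣 𝓘(ℝ, ℝ)) 𝓘(ℝ, 𝔼 4) ∞ J.iotaTwo (Sh (x, s)) := by
      refine J.isLocalDiffeomorphAt_iotaTwo HL (x := J.Ψ H x) (s := s + 1) ?_
      rw [Ψ_fst]; exact hx
    exact h1.comp (K := 𝓘(ℝ, 𝔼 4)) (P := (fishNu J.hε J.hε2).Surgered) h2
  unfold iotaOne
  refine isLocalDiffeomorphAt_glueBy_of_continuousOn (S := univ) isOpen_univ continuous_snd.continuousOn (δ := 1 / 4)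
    (by norm_num) (mem_univ _) (fun p _ hp ↦ ?_) (fun _ ↦ hshift) (fun _ ↦ J.isLocalDiffeomorphAt_iotaTwo HL hx)
  obtain ⟨h1, h2⟩ := abs_lt.1 hp
  exact J.iotaTwo_Ψ H hrh HL.hrc1 ⟨by linarith, by linarith⟩

/-- **The fishtail end map is a local diffeomorphism at every point of the model end.** [cite: GompfAGT2010, Lemma 2.2 (the fishtail neighbourhood Φ = N ∪_γ h embedded in X; here the collar of its end)] -/
theorem isLocalDiffeomorphAt_iota (H : J.ModelHyp) (HL : J.LocHyp δ) {p : MTorus (J.Ψ H)} (hp : p ∈ J.endO H) :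
    IsLocalDiffeomorphAt 𝓘(ℝ, 𝔼 4) 𝓘(ℝ, 𝔼 4) ∞ (J.iota H) p := by
  rcases (mtGlueData (J.Ψ H)).exists_inl_or_inr p with ⟨a, rfl⟩ | ⟨b, rfl⟩
  · -- first cylinder
    have hx : 0 < (a.1.1 : ℂ).im := hp
    have hinl : IsLocalDiffeomorphAt (ModelWithCorners.prod 𝓣 𝓘(ℝ, ℝ)) 𝓘(ℝ, 𝔼 4) ∞ (mtGlueData (J.Ψ H)).inl a :=
      isLocalDiffeomorphAt_of_isSmoothEmbedding (mtGlueData (J.Ψ H)).isSmoothEmbedding_inl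
        (mtGlueData (J.Ψ H)).isOpen_range_inl a
    refine isLocalDiffeomorphAt_of_comp_left hinl ?_
    -- `ι ∘ inl = iotaOne ∘ (x, s) ↦ (x, ↑s)`
    have hval : IsLocalDiffeomorphAt (ModelWithCorners.prod 𝓣 𝓘(ℝ, ℝ)) (ModelWithCorners.prod 𝓣 𝓘(ℝ, ℝ)) ∞
        (Prod.map id (Subtype.val : ↥mappingTorusPieceOne → ℝ)) a :=
      IsLocalDiffeomorphAt.prodMap' ((Diffeomorph.refl 𝓣 ThreeTorus ∞).isLocalDiffeomorph a.1)
        (pieceOneMk.symm.isLocalDiffeomorphAt 𝓘(ℝ, ℝ) 𝓘(ℝ, ℝ) ∞ (x := a.2) (mem_univ _))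
    have h := hval.comp (K := 𝓘(ℝ, 𝔼 4)) (P := (fishNu J.hε J.hε2).Surgered) (J.isLocalDiffeomorphAt_iotaOne H HL (s := (a.2 : ℝ)) hx)
    exact isLocalDiffeomorphAt_congr_nhds' h (Eventually.of_forall fun a' ↦ rfl)
  · have hx : 0 < (b.1.1 : ℂ).im := hp
    have hinr : IsLocalDiffeomorphAt (ModelWithCorners.prod 𝓣 𝓘(ℝ, ℝ)) 𝓘(ℝ, 𝔼 4) ∞ (mtGlueData (J.Ψ H)).inr b :=
      isLocalDiffeomorphAt_of_isSmoothEmbedding (mtGlueData (J.Ψ H)).isSmoothEmbedding_inr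
        (mtGlueData (J.Ψ H)).isOpen_range_inr b
    refine isLocalDiffeomorphAt_of_comp_left hinr ?_
    have hval : IsLocalDiffeomorphAt (ModelWithCorners.prod 𝓣 𝓘(ℝ, ℝ)) (ModelWithCorners.prod 𝓣 𝓘(ℝ, ℝ)) ∞
        (Prod.map id (Subtype.val : ↥mappingTorusPieceTwo → ℝ)) b :=
      IsLocalDiffeomorphAt.prodMap' ((Diffeomorph.refl 𝓣 ThreeTorus ∞).isLocalDiffeomorph b.1)
        (pieceTwoMk.symm.isLocalDiffeomorphAt 𝓘(ℝ, ℝ) 𝓘(ℝ, ℝ) ∞ (x := b.2) (mem_univ _))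
    have h := hval.comp (K := 𝓘(ℝ, 𝔼 4)) (P := (fishNu J.hε J.hε2).Surgered) (J.isLocalDiffeomorphAt_iotaTwo HL (s := (b.2 : ℝ)) hx)
    exact isLocalDiffeomorphAt_congr_nhds' h (Eventually.of_forall fun b' ↦ rfl)

/-- **The fishtail end map is smooth on the model end.** [folklore] -/
theorem contMDiffAt_iota (H : J.ModelHyp) (HL : J.LocHyp δ) {p : MTorus (J.Ψ H)} (hp : p ∈ J.endO H) :
    ContMDiffAt 𝓘(ℝ, 𝔼 4) 𝓘(ℝ, 𝔼 4) ∞ (J.iota H) p :=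
  (J.isLocalDiffeomorphAt_iota H HL hp).contMDiffAt

/-- **The end map restricted to the model end**, as a map of the open submanifold. [folklore] -/
def iotaO (H : J.ModelHyp) (p : ↥(J.endO H)) : (fishNu J.hε J.hε2).Surgered := J.iota H p

/-- The restricted end map is a local diffeomorphism everywhere. [folklore] -/
theorem isLocalDiffeomorph_iotaO (H : J.ModelHyp) (HL : J.LocHyp δ) :
    IsLocalDiffeomorph 𝓘(ℝ, 𝔼 4) 𝓘(ℝ, 𝔼 4) ∞ (J.iotaO H) := fun p ↦ by
  have h1 : IsLocalDiffeomorphAt 𝓘(ℝ, 𝔼 4) 𝓘(ℝ, 𝔼 4) ∞ (Subtype.val : ↥(J.endO H) → MTorus (J.Ψ H)) p :=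
    isLocalDiffeomorphAt_subtypeVal_opens (J.endO H) p
  exact h1.comp (K := 𝓘(ℝ, 𝔼 4)) (P := (fishNu J.hε J.hε2).Surgered) (J.isLocalDiffeomorphAt_iota H HL p.2)

end IotaData

end Literature.Topology.FourManifolds
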